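import Summits.QuantumFields.BalabanUV.Beta.GAN24.CombBornLambdaLift
import Summits.QuantumFields.BalabanUV.Beta.GAN24.CombBornLambdaSocket
import Summits.QuantumFields.BalabanUV.Beta.GAN24.TaylorRowLamSymAt
import Summits.QuantumFields.BalabanUV.Beta.GAN24.TaylorRowLamTopSymAt
import Summits.QuantumFields.BalabanUV.Beta.GAN24.S3ShapeL0SymAt
import Summits.QuantumFields.BalabanUV.Beta.GAN24.BornLambdaUndressedRow

/-!
# THE UNDRESSED Λ-LINEAGE LETTER `hUg-Λ` OF THE (III′) BORN ROW AT an1's SYM TABLE — UNCONDITIONAL at `d = 3`, `2 ≤ Lc`, pin `cE = Lc^4`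
# (the comb ∕ sym twin of the OWNER's (Λ-U) `BornLambdaUndressedRow` + `BornLambdaRowHolds` §1)

NOT IN PRINT — OUR BOOKKEEPING (road-P2 = `b2b-balaban-gan24-p2` gen 56, 2026-08-25; row G-an2-4 ∕ (CONV-C), the (α-0) chain at row D1's literal
OF RECORD (III′) `JsB12CombShSym`; [folklore] composition BY NAME; 0 `def`, 0 cite, 0 `def … : Prop`, 0 `sorry`).  Weight 0.  NEVER «G-an2-4 closed» as (CONV-C);
NOT D1, NOT BetaPertH, NOT continuum, NOT Clay; NO campaign opened (an2 W-4) — the LAST brick of the located `hUg-Λ` transfer (road-P2 MEMO M-gan24p2-g56-1).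

Over M.75 `CombBornLambdaLift` (the undressed comb Λ-lineages ARE road S3's sym row objects: `lineage_succ_eq_e3OfS_symLagrIncAt`, `lineage_zero_eq_e3OfS_sym`), M.58
(`exists_locStencil_combLamPiece_zero`, `unitS_combFreshAt_lam_zero`), the three SYM rows M.69 `TaylorRowLamSymAt.rowL_three_at` ∕ M.72 `TaylorRowLamTopSymAt.rowLamTop_at` ∕
M.74 `S3ShapeL0SymAt.rowL0_holds_at`, M.60 `CombBornLambdaSocket.exists_hU_of_geometric ∕ exists_hBLam_of_geometric_three` and the OWNER's root-free `e3OfS_smul` BY NAME, for ANY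
`tabs : SymTables 3 Lc` with ff-valued Hessian table EQUAL TO an1's sym table at a box root (`hHff`, `hH : tabs.H = symHessFFAt (toSite rr) Lc`, `rr ∈ box (3+1) Lc` — the record's
`symTablesAn1S2` at `rr = ctrOff`):
* §1 (generic `d`) `exists_locStencil_member_zero_one` (the member `(0,1)`); §2 the pin lemmas `lineage_succ_pin_apply ∕ lineage_top_pin_apply ∕ lineage_zero_pin_apply` (the weighted comb
  lineages = `Lc^4 ·` road S3's SYM row values, Q22's exponent identity); §3 `locStencil_lineage_succ ∕ top ∕ zero_of_row` and the SOCKET **`exists_hUg_of_symRows`** (the OWNER's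
  assembly token for token, rows as hypotheses, the in-block-root quantifier of the conclusion gone — the comb source has none).
* §4 THE ENDs: **`exists_hUg_three (tabs) (hHff) (hLc : 2 ≤ Lc) (hrr) (hH) (hcE : cE = Lc^4) (cΛ) : ∃ C θ δ, 0 ≤ C ∧ 0 ≤ θ ∧ θ < 1 ∧ 0 < δ ∧ ∀ k i, i < k →
  LocStencil ((cE·Lc^8)^{k−i} • push₃ (respStep (Lc^i) (Lc^k))³ (unitS_i (combFreshAt tabs 0 cΛ i))) (C·θ^{k−i}) δ`** — UNCONDITIONAL (the three SYM rows plugged in) = the letter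
  `hUg` of M.60 VERBATIM; **`exists_hU_three`** (the summed letter `hU` of M.60 `exists_hBLam_of_letters_three`); **`exists_hBLam_three_of_contact`** (the (III′) Λ-born ROW from the
  contact letter `hCg` ALONE).
SCORE after this file (located): (III′) born ROW `hB ⟸ (hUv ∧ hCv) ∧ (hUg-Λ ✓ ∧ hCg-Λ)` — 1∕4 per-lineage row letters DISCHARGED at the record's table.  The estimates inside are the
TREE's `legs_three ∕ phiLeg_three` ((N1) + the K-slot) through the sym rows — NO new estimate, NO value ∕ rate of Bałaban's tables asserted beyond them.
-/

noncomputable section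

open Finset
open scoped BigOperators
open Literature.MathematicalPhysics.QuantumFieldTheory
open Literature.MathematicalPhysics.QuantumFieldTheory.Balaban1983to89
open Literature.MathematicalPhysics.QuantumFieldTheory.Balaban1983to89.Beta
open ExpKernelCalculus (MKer Decays)
open AffineAveraging (box toSite)
open AveragingContoursRooted (ctr ctrOff ctrOff_mem_box)
open OneStepResolventKernel (Fib LocStencil KInv decays_KInv)
open OneStepKernelFamily (colH)
open StepJetData (locStencil_smul)
open BalabanStepJets (lamCoeffOf locStencil_mono)
open BalabanCompositeJets (respStep)
open InterLevelTransport (SLam)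
open Summit.QuantumFields.BalabanUV.Beta.HessKerDressedUnits (unitS)
open Summit.QuantumFields.BalabanUV.Beta.SymmetrisedStepJets (SymTables)
open Summit.QuantumFields.BalabanUV.Beta.SymAveragingHessianCounts (symHessFFAt)
open Summit.QuantumFields.BalabanUV.Beta.SymCorrectorKernel (psiKS)
open Summit.QuantumFields.BalabanUV.Beta.GAN24.CombesThomas (sfStep smStep)
open Summit.QuantumFields.BalabanUV.Beta.GAN24.StencilSlotOfShapes (locStencil_mono')
open Summit.QuantumFields.BalabanUV.Beta.GAN24.Push4 (IsFF legComp)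
open Summit.QuantumFields.BalabanUV.Beta.GAN24.Push4Bounds (LegDecay legDecay_colH)
open Summit.QuantumFields.BalabanUV.Beta.GAN24.Push4Iter (legChain)
open Summit.QuantumFields.BalabanUV.Beta.GAN24.Push3 (push₃ cPush₃ locStencil_push₃_mono)
open Summit.QuantumFields.BalabanUV.Beta.GAN24.RespStepBmDecompExact (respStepBmSeq)
open Summit.QuantumFields.BalabanUV.Beta.GAN24.E3UnitSplit (e3OfS)
open Summit.QuantumFields.BalabanUV.Beta.GAN24.E3UnitSplitLevelsSymAt (symLagrIncAt)
open Summit.QuantumFields.BalabanUV.Beta.GAN24.WilsonSectorUndressedRow (colH_KInv_eq_respStep_one)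
open Summit.QuantumFields.BalabanUV.Beta.GAN24.BornLambdaUndressedRow (e3OfS_smul)
open Summit.QuantumFields.BalabanUV.Beta.GAN24.TaylorRowLamSymAt (rowL_three_at)
open Summit.QuantumFields.BalabanUV.Beta.GAN24.TaylorRowLamTopSymAt (rowLamTop_at)
open Summit.QuantumFields.BalabanUV.Beta.GAN24.S3ShapeL0SymAt (rowL0_holds_at)
open Summit.QuantumFields.BalabanUV.Beta.GAN24.CombWilsonSector (combBornOf)
open Summit.QuantumFields.BalabanUV.Beta.GAN24.CombBornSector (combFreshAt)
open Summit.QuantumFields.BalabanUV.Beta.GAN24.CombBornLambdaLineage (unitS_combFreshAt_lam_zero exists_locStencil_combLamPiece_zero)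
open Summit.QuantumFields.BalabanUV.Beta.GAN24.CombBornLambdaSocket (exists_hU_of_geometric exists_hBLam_of_geometric_three)
open Summit.QuantumFields.BalabanUV.Beta.GAN24.CombBornLambdaLift (lineage_succ_eq_e3OfS_symLagrIncAt lineage_zero_eq_e3OfS_sym)

namespace Summit.QuantumFields.BalabanUV.Beta.GAN24.CombBornLambdaUndressedRow

variable {d : ℕ}

/-! ## §1 The member `(0, 1)` -/
section MemberZeroOne

variable {Lc : ℕ} [NeZero Lc] (tabs : SymTables d Lc)

/-- NOT IN PRINT; OUR BOOKKEEPING ([folklore]; generic `d`; the (III′) twin of the OWNER's `exists_locStencil_member_zero_one`).  **THE LINEAGE BORN AT LEVEL `0` READ AT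
LEVEL `1` IS A LOCAL STENCIL FAMILY**, for every scalar weight `w`: the member `0`'s Λ-piece `cΛ • S^Λ[lamCoeffOf (KInv Lc)] tabs.H` is local (M.58
`exists_locStencil_combLamPiece_zero`), and ONE three-leg push through the decaying one-shot column legs `respStep 1 Lc = colH (KInv Lc) Lc` keeps locality with an explicit carrier
constant (`Push3.locStencil_push₃_mono`). -/
theorem exists_locStencil_member_zero_one (hLc : 1 ≤ Lc) (w cΛ : ℝ) :
    ∃ C δ : ℝ, 0 < δ ∧
      LocStencil (fun κ' u' => w •
        push₃ (respStep (d := d) (Lc ^ 0) (Lc ^ 1)) (respStep (d := d) (Lc ^ 0) (Lc ^ 1)) (respStep (d := d) (Lc ^ 0) (Lc ^ 1))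
          (unitS (sfStep Lc 0) (smStep d Lc 0) (combFreshAt tabs 0 cΛ 0)) κ' u') C δ := by
  obtain ⟨C0, δ0, hδ0, h0⟩ := exists_locStencil_combLamPiece_zero tabs cΛ
  obtain ⟨δK, CK, hδK, -, hK⟩ := decays_KInv (N := Lc ^ 1) (d := d)
  have hδ'0 : 0 < min δ0 (δK / 3) := lt_min hδ0 (by positivity)
  have h2 : 2 * min δ0 (δK / 3) < δK := by linarith [min_le_right δ0 (δK / 3)]
  have hleg : LegDecay (respStep (d := d) (Lc ^ 0) (Lc ^ 1)) (Lc ^ 1) CK δK := by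
    rw [pow_zero, ← colH_KInv_eq_respStep_one]
    exact legDecay_colH hK
  have hN : 1 ≤ Lc ^ 1 := by rw [pow_one]; exact hLc
  refine ⟨|w| * (cPush₃ d CK CK CK δK (min δ0 (δK / 3)) * C0), min δ0 (δK / 3), hδ'0, ?_⟩
  have hC0 : 0 ≤ C0 := (h0 0 0).nonneg (Sum.inl 0)
  have hS : LocStencil (unitS (sfStep Lc 0) (smStep d Lc 0) (combFreshAt tabs 0 cΛ 0)) C0 (min δ0 (δK / 3)) := by
    rw [unitS_combFreshAt_lam_zero]
    exact locStencil_mono h0 hC0 (min_le_left _ _)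
  exact locStencil_smul w (locStencil_push₃_mono hN hleg hleg hleg hS hδ'0.le h2)

end MemberZeroOne

/-! ## §2 `d = 3`, pin `cE = Lc^4`: the comb summands are `Lc^4 ·` road S3's rooted row objects (the exponent identity, Q22) -/

section Pin

variable {Lc : ℕ} [NeZero Lc] (tabs : SymTables 3 Lc) (hHff : ∀ μ y, IsFF (tabs.H μ y))
include hHff

/-- NOT IN PRINT; OUR BOOKKEEPING ([folklore]; Q22's exponent identity for road S3-L ∕ S3-Lt).  **BIRTH `j+1`, READ `j+n+2`**: pointwise, the weighted undressed
comb lineage equals `Lc^4` times road S3's row-Λ value at `(n′, m) = (j+n, j)` and the same in-block root: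
`(cE·Lc^8)^{n+1}·push₃ B³ X_{j+1} = Lc^4 · [(Lc^(j+n+2))^8 · e3OfS (Lc^(j+n+2)) (((Lc^4)^{(j+n)−j}·cΛ·(Lc^(j+1))^{10}) • lagrIncAt 3 ρ Lc (Lc^(j+1)) (Lc^(j+2)))]`
(`Lc^{12(n+1)}·Lc^{18(j+1)} = Lc^4·Lc^{8(j+n+2)}·Lc^{4n}·Lc^{10(j+1)}`). -/
theorem lineage_succ_pin_apply {rr : Fin (3 + 1) → ℕ} (hH : tabs.H = symHessFFAt (toSite rr) Lc) {cE : ℝ} (hcE : cE = (Lc : ℝ) ^ (3 + 1))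
    (cΛ : ℝ) (j n : ℕ) (κ' : Fin (3 + 1)) (u' x' z' : Fin (3 + 1) → ℤ) (a b : Fib 3) :
    ((cE * (Lc : ℝ) ^ (2 * (3 + 1))) ^ (n + 1) •
        push₃ (respStep (d := 3) (Lc ^ (j + 1)) (Lc ^ (j + n + 1 + 1))) (respStep (d := 3) (Lc ^ (j + 1)) (Lc ^ (j + n + 1 + 1)))
          (respStep (d := 3) (Lc ^ (j + 1)) (Lc ^ (j + n + 1 + 1)))
          (unitS (sfStep Lc (j + 1)) (smStep 3 Lc (j + 1)) (combFreshAt tabs 0 cΛ (j + 1))) κ' u') x' z' a b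
      = (Lc : ℝ) ^ (3 + 1) * (((Lc : ℝ) ^ (j + n + 1 + 1)) ^ (2 * (3 + 1)) *
          e3OfS (Lc ^ (j + n + 1 + 1)) (fun κ u => (((Lc : ℝ) ^ (3 + 1)) ^ (j + n - j) * (cΛ * ((Lc : ℝ) ^ (j + 1)) ^ (2 * 3 + 4))) •
            symLagrIncAt 3 (toSite rr) Lc (Lc ^ (j + 1)) (Lc ^ (j + 1 + 1)) κ u) κ' u' x' z' a b) := by
  rw [Pi.smul_apply, Pi.smul_apply, Pi.smul_apply, Pi.smul_apply, smul_eq_mul, lineage_succ_eq_e3OfS_symLagrIncAt (d := 3) tabs hHff hH cΛ j n κ' u',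
    e3OfS_smul, e3OfS_smul, Pi.smul_apply, Pi.smul_apply, Pi.smul_apply, Pi.smul_apply, smul_eq_mul, Pi.smul_apply, Pi.smul_apply,
    Pi.smul_apply, Pi.smul_apply, smul_eq_mul, Nat.add_sub_cancel_left]
  subst hcE
  ring

/-- NOT IN PRINT; OUR BOOKKEEPING ([folklore]; the top member `k = i+1`).  **BIRTH `j+1`, READ `j+2`**: the weighted comb lineage (ONE push) equals `Lc^4`
times road S3's row-Λt value at `n′ = j`: `(cE·Lc^8)·push₃ B³ X_{j+1} = Lc^4 · [(Lc^(j+2))^8 · e3OfS (Lc^(j+2)) ((cΛ·(Lc^(j+1))^{10}) • lagrIncAt 3 ρ Lc (Lc^(j+1)) (Lc^(j+2)))]`. -/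
theorem lineage_top_pin_apply {rr : Fin (3 + 1) → ℕ} (hH : tabs.H = symHessFFAt (toSite rr) Lc) {cE : ℝ} (hcE : cE = (Lc : ℝ) ^ (3 + 1))
    (cΛ : ℝ) (j : ℕ) (κ' : Fin (3 + 1)) (u' x' z' : Fin (3 + 1) → ℤ) (a b : Fib 3) :
    ((cE * (Lc : ℝ) ^ (2 * (3 + 1))) ^ 1 •
        push₃ (respStep (d := 3) (Lc ^ (j + 1)) (Lc ^ (j + 1 + 1))) (respStep (d := 3) (Lc ^ (j + 1)) (Lc ^ (j + 1 + 1)))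
          (respStep (d := 3) (Lc ^ (j + 1)) (Lc ^ (j + 1 + 1)))
          (unitS (sfStep Lc (j + 1)) (smStep 3 Lc (j + 1)) (combFreshAt tabs 0 cΛ (j + 1))) κ' u') x' z' a b
      = (Lc : ℝ) ^ (3 + 1) * (((Lc : ℝ) ^ (j + 1 + 1)) ^ (2 * (3 + 1)) *
          e3OfS (Lc ^ (j + 1 + 1)) (fun κ u => (cΛ * ((Lc : ℝ) ^ (j + 1)) ^ (2 * 3 + 4)) •
            symLagrIncAt 3 (toSite rr) Lc (Lc ^ (j + 1)) (Lc ^ (j + 1 + 1)) κ u) κ' u' x' z' a b) := by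
  have h := lineage_succ_eq_e3OfS_symLagrIncAt (d := 3) tabs hHff hH cΛ j 0 κ' u'
  simp only [Nat.add_zero] at h
  rw [Pi.smul_apply, Pi.smul_apply, Pi.smul_apply, Pi.smul_apply, smul_eq_mul, h, e3OfS_smul, e3OfS_smul, Pi.smul_apply, Pi.smul_apply,
    Pi.smul_apply, Pi.smul_apply, smul_eq_mul, Pi.smul_apply, Pi.smul_apply, Pi.smul_apply, Pi.smul_apply, smul_eq_mul]
  subst hcE
  ring

/-- NOT IN PRINT; OUR BOOKKEEPING ([folklore]; Q22's exponent identity for road S3-L0).  **BIRTH `0`, READ `n+2`**: the weighted comb lineage equals `Lc^4` times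
road S3's row-Λ0 value at `n`: `(cE·Lc^8)^{n+2}·push₃ B³ X_0 = Lc^4 · [(Lc^(n+2))^8 · e3OfS (Lc^(n+2)) (((Lc^4)^{n+1}·cΛ) • S^Λ[lamCoeffOf (KInv Lc)] H_ρ)]`
(`Lc^{12(n+2)} = Lc^4·Lc^{8(n+2)}·Lc^{4(n+1)}`). -/
theorem lineage_zero_pin_apply {rr : Fin (3 + 1) → ℕ} (hH : tabs.H = symHessFFAt (toSite rr) Lc) {cE : ℝ} (hcE : cE = (Lc : ℝ) ^ (3 + 1)) (cΛ : ℝ) (n : ℕ) (κ' : Fin (3 + 1))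
    (u' x' z' : Fin (3 + 1) → ℤ) (a b : Fib 3) :
    ((cE * (Lc : ℝ) ^ (2 * (3 + 1))) ^ (n + 1 + 1) •
        push₃ (respStep (d := 3) (Lc ^ 0) (Lc ^ (n + 1 + 1))) (respStep (d := 3) (Lc ^ 0) (Lc ^ (n + 1 + 1)))
          (respStep (d := 3) (Lc ^ 0) (Lc ^ (n + 1 + 1)))
          (unitS (sfStep Lc 0) (smStep 3 Lc 0) (combFreshAt tabs 0 cΛ 0)) κ' u') x' z' a b
      = (Lc : ℝ) ^ (3 + 1) * (((Lc : ℝ) ^ (n + 1 + 1)) ^ (2 * (3 + 1)) *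
          e3OfS (Lc ^ (n + 1 + 1)) (fun κ u => (((Lc : ℝ) ^ (3 + 1)) ^ (n + 1) * cΛ) •
            SLam Lc (lamCoeffOf (KInv (N := Lc) (d := 3)) Lc) (fun μ y => symHessFFAt (toSite rr) Lc μ y) κ u) κ' u' x' z' a b) := by
  rw [Pi.smul_apply, Pi.smul_apply, Pi.smul_apply, Pi.smul_apply, smul_eq_mul, lineage_zero_eq_e3OfS_sym (d := 3) tabs hHff hH cΛ (n + 1 + 1) κ' u',
    e3OfS_smul, e3OfS_smul, Pi.smul_apply, Pi.smul_apply, Pi.smul_apply, Pi.smul_apply, smul_eq_mul, Pi.smul_apply, Pi.smul_apply,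
    Pi.smul_apply, Pi.smul_apply, smul_eq_mul]
  subst hcE
  ring

end Pin

/-! ## §3 `d = 3`: the undressed-lineage letter `hUg` from road S3's three Λ rows at the in-block root -/

section Socket

variable {Lc : ℕ} [NeZero Lc] (tabs : SymTables 3 Lc) (hHff : ∀ μ y, IsFF (tabs.H μ y))
include hHff

/-- NOT IN PRINT; OUR BOOKKEEPING ([folklore]).  A local-stencil letter for road S3-L's rooted value at `(n′, m) = (j+n, j)` gives one for the comb summand
(birth `j+1`, read `j+n+2`), constant `× Lc^4`. -/
theorem locStencil_lineage_succ_of_row {rr : Fin (3 + 1) → ℕ} (hH : tabs.H = symHessFFAt (toSite rr) Lc) {cE : ℝ} (hcE : cE = (Lc : ℝ) ^ (3 + 1))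
    (cΛ : ℝ) (j n : ℕ) {c δ : ℝ}
    (h : LocStencil (fun κ' u' x' z' a b => ((Lc : ℝ) ^ (j + n + 1 + 1)) ^ (2 * (3 + 1)) *
      e3OfS (Lc ^ (j + n + 1 + 1)) (fun κ u => (((Lc : ℝ) ^ (3 + 1)) ^ (j + n - j) * (cΛ * ((Lc : ℝ) ^ (j + 1)) ^ (2 * 3 + 4))) •
        symLagrIncAt 3 (toSite rr) Lc (Lc ^ (j + 1)) (Lc ^ (j + 1 + 1)) κ u) κ' u' x' z' a b) c δ) :
    LocStencil (fun κ' u' => (cE * (Lc : ℝ) ^ (2 * (3 + 1))) ^ (n + 1) •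
        push₃ (respStep (d := 3) (Lc ^ (j + 1)) (Lc ^ (j + n + 1 + 1))) (respStep (d := 3) (Lc ^ (j + 1)) (Lc ^ (j + n + 1 + 1)))
          (respStep (d := 3) (Lc ^ (j + 1)) (Lc ^ (j + n + 1 + 1)))
          (unitS (sfStep Lc (j + 1)) (smStep 3 Lc (j + 1)) (combFreshAt tabs 0 cΛ (j + 1))) κ' u') ((Lc : ℝ) ^ (3 + 1) * c) δ := by
  intro κ' u' x' z' a b
  have hx := h κ' u' x' z' a b
  beta_reduce at hx
  beta_reduce
  rw [lineage_succ_pin_apply tabs hHff hH hcE cΛ j n κ' u' x' z' a b, abs_mul, abs_of_nonneg (by positivity : (0 : ℝ) ≤ (Lc : ℝ) ^ (3 + 1)), mul_assoc]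
  exact mul_le_mul_of_nonneg_left hx (by positivity)

/-- NOT IN PRINT; OUR BOOKKEEPING ([folklore]).  The same for the top member (road S3-Lt's rooted value at `n′ = j`; birth `j+1`, read `j+2`). -/
theorem locStencil_lineage_top_of_row {rr : Fin (3 + 1) → ℕ} (hH : tabs.H = symHessFFAt (toSite rr) Lc) {cE : ℝ} (hcE : cE = (Lc : ℝ) ^ (3 + 1))
    (cΛ : ℝ) (j : ℕ) {c δ : ℝ}
    (h : LocStencil (fun κ' u' x' z' a b => ((Lc : ℝ) ^ (j + 1 + 1)) ^ (2 * (3 + 1)) *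
      e3OfS (Lc ^ (j + 1 + 1)) (fun κ u => (cΛ * ((Lc : ℝ) ^ (j + 1)) ^ (2 * 3 + 4)) •
        symLagrIncAt 3 (toSite rr) Lc (Lc ^ (j + 1)) (Lc ^ (j + 1 + 1)) κ u) κ' u' x' z' a b) c δ) :
    LocStencil (fun κ' u' => (cE * (Lc : ℝ) ^ (2 * (3 + 1))) ^ 1 •
        push₃ (respStep (d := 3) (Lc ^ (j + 1)) (Lc ^ (j + 1 + 1))) (respStep (d := 3) (Lc ^ (j + 1)) (Lc ^ (j + 1 + 1)))
          (respStep (d := 3) (Lc ^ (j + 1)) (Lc ^ (j + 1 + 1)))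
          (unitS (sfStep Lc (j + 1)) (smStep 3 Lc (j + 1)) (combFreshAt tabs 0 cΛ (j + 1))) κ' u') ((Lc : ℝ) ^ (3 + 1) * c) δ := by
  intro κ' u' x' z' a b
  have hx := h κ' u' x' z' a b
  beta_reduce at hx
  beta_reduce
  rw [lineage_top_pin_apply tabs hHff hH hcE cΛ j κ' u' x' z' a b, abs_mul, abs_of_nonneg (by positivity : (0 : ℝ) ≤ (Lc : ℝ) ^ (3 + 1)), mul_assoc]
  exact mul_le_mul_of_nonneg_left hx (by positivity)

/-- NOT IN PRINT; OUR BOOKKEEPING ([folklore]).  The same for the birth-`0` lineages (road S3-L0's rooted value at `n`; read `n+2`). -/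
theorem locStencil_lineage_zero_of_row {rr : Fin (3 + 1) → ℕ} (hH : tabs.H = symHessFFAt (toSite rr) Lc) {cE : ℝ} (hcE : cE = (Lc : ℝ) ^ (3 + 1)) (cΛ : ℝ) (n : ℕ) {c δ : ℝ}
    (h : LocStencil (fun κ' u' x' z' a b => ((Lc : ℝ) ^ (n + 1 + 1)) ^ (2 * (3 + 1)) *
      e3OfS (Lc ^ (n + 1 + 1)) (fun κ u => (((Lc : ℝ) ^ (3 + 1)) ^ (n + 1) * cΛ) •
        SLam Lc (lamCoeffOf (KInv (N := Lc) (d := 3)) Lc) (fun μ y => symHessFFAt (toSite rr) Lc μ y) κ u) κ' u' x' z' a b) c δ) :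
    LocStencil (fun κ' u' => (cE * (Lc : ℝ) ^ (2 * (3 + 1))) ^ (n + 1 + 1) •
        push₃ (respStep (d := 3) (Lc ^ 0) (Lc ^ (n + 1 + 1))) (respStep (d := 3) (Lc ^ 0) (Lc ^ (n + 1 + 1)))
          (respStep (d := 3) (Lc ^ 0) (Lc ^ (n + 1 + 1)))
          (unitS (sfStep Lc 0) (smStep 3 Lc 0) (combFreshAt tabs 0 cΛ 0)) κ' u') ((Lc : ℝ) ^ (3 + 1) * c) δ := by
  intro κ' u' x' z' a b
  have hx := h κ' u' x' z' a b
  beta_reduce at hx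
  beta_reduce
  rw [lineage_zero_pin_apply tabs hHff hH hcE cΛ n κ' u' x' z' a b, abs_mul, abs_of_nonneg (by positivity : (0 : ℝ) ≤ (Lc : ℝ) ^ (3 + 1)), mul_assoc]
  exact mul_le_mul_of_nonneg_left hx (by positivity)

/-- NOT IN PRINT; OUR BOOKKEEPING ([folklore] assembly; the (III′) twin of the OWNER's `exists_hUg_of_rootedRows`, the rows as HYPOTHESES).  **THE UNDRESSED-LINEAGE LETTER
`hUg` OF THE (III′) Λ-BORN ROW AT THE SYM TABLE** (`d = 3`, `2 ≤ Lc`, the literal's pin `cE = Lc^4`): from the rooted rows `rowL_three_at` (S3-L: birth `m+1 ≥ 1`, read `n+2 ≥ m+3`,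
constant `cL·(Lc⁻¹)^{n−m}`), `rowLamTop_at` (S3-Lt: read one level above birth, constant `CtL`) and `rowL0_holds_at` (S3-L0: birth `0`, read `n+2`, constant
`c₀L·(Lc⁻¹)^{n+1}`) — each with ONE constant and ONE rate BEFORE the in-block root — every weighted undressed Λ-lineage of the comb family,
`(cE·Lc^8)^{k−i} • push₃ (respStep (Lc^i) (Lc^k))³ (unitS_i (combFreshAt tabs 0 cΛ i))` (`tabs.H = symHessFFAt (toSite rr) Lc`, `rr ∈ box`), `i < k`, is a local stencil family with constant `C·θ^{k−i}`, `θ = Lc⁻¹ < 1`,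
`C = Lc·(Lc^4·(max cL 0 + max CtL 0 + c₀L) + max C₀₁ 0)`, at the minimum rate — VERBATIM the hypothesis `hUg` of M.60 `CombBornLambdaSocket.exists_hBLam_of_geometric_three`.
The member `(i, k) = (0, 1)` is §1; the three SYM rows are M.69 ∕ M.72 ∕ M.74 (plugged in `exists_hUg_three` below). -/
theorem exists_hUg_of_symRows (hLc : 2 ≤ Lc) {rr : Fin (3 + 1) → ℕ} (hrr : rr ∈ box (3 + 1) Lc) (hH : tabs.H = symHessFFAt (toSite rr) Lc)
    {cE : ℝ} (hcE : cE = (Lc : ℝ) ^ (3 + 1)) (cΛ : ℝ)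
    (hL : ∃ cL δL : ℝ, 0 < δL ∧ ∀ (r : Fin (3 + 1) → ℕ), r ∈ box (3 + 1) Lc → ∀ n m : ℕ, m < n →
      LocStencil (fun κ' u' x' z' a b => ((Lc : ℝ) ^ (n + 1 + 1)) ^ (2 * (3 + 1)) *
        e3OfS (Lc ^ (n + 1 + 1)) (fun κ u => (((Lc : ℝ) ^ (3 + 1)) ^ (n - m) * (cΛ * ((Lc : ℝ) ^ (m + 1)) ^ (2 * 3 + 4))) •
          symLagrIncAt 3 (toSite r) Lc (Lc ^ (m + 1)) (Lc ^ (m + 1 + 1)) κ u) κ' u' x' z' a b) (cL * ((Lc : ℝ)⁻¹) ^ (n - m)) δL)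
    (hLt : ∃ CtL δt : ℝ, 0 < δt ∧ ∀ (r : Fin (3 + 1) → ℕ), r ∈ box (3 + 1) Lc → ∀ n : ℕ,
      LocStencil (fun κ' u' x' z' a b => ((Lc : ℝ) ^ (n + 1 + 1)) ^ (2 * (3 + 1)) *
        e3OfS (Lc ^ (n + 1 + 1)) (fun κ u => (cΛ * ((Lc : ℝ) ^ (n + 1)) ^ (2 * 3 + 4)) •
          symLagrIncAt 3 (toSite r) Lc (Lc ^ (n + 1)) (Lc ^ (n + 1 + 1)) κ u) κ' u' x' z' a b) CtL δt)
    (hL0 : ∃ c₀L δ0 : ℝ, 0 ≤ c₀L ∧ 0 < δ0 ∧ ∀ (r : Fin (3 + 1) → ℕ), r ∈ box (3 + 1) Lc → ∀ n : ℕ,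
      LocStencil (fun κ' u' x' z' a b => ((Lc : ℝ) ^ (n + 1 + 1)) ^ (2 * (3 + 1)) *
        e3OfS (Lc ^ (n + 1 + 1)) (fun κ u => (((Lc : ℝ) ^ (3 + 1)) ^ (n + 1) * cΛ) •
          SLam Lc (lamCoeffOf (KInv (N := Lc) (d := 3)) Lc) (fun μ y => symHessFFAt (toSite r) Lc μ y) κ u) κ' u' x' z' a b)
        (c₀L * ((Lc : ℝ)⁻¹) ^ (n + 1)) δ0) :
    ∃ C θ δ : ℝ, 0 ≤ C ∧ 0 ≤ θ ∧ θ < 1 ∧ 0 < δ ∧ ∀ k i : ℕ, i < k →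
      LocStencil (fun κ' u' => (cE * (Lc : ℝ) ^ (2 * (3 + 1))) ^ (k - i) •
        push₃ (respStep (d := 3) (Lc ^ i) (Lc ^ k)) (respStep (d := 3) (Lc ^ i) (Lc ^ k)) (respStep (d := 3) (Lc ^ i) (Lc ^ k))
          (unitS (sfStep Lc i) (smStep 3 Lc i) (combFreshAt tabs 0 cΛ i)) κ' u') (C * θ ^ (k - i)) δ := by
  have hLc1 : 1 ≤ Lc := le_trans (by norm_num) hLc
  have hLpos : (0 : ℝ) < Lc := by exact_mod_cast Nat.pos_of_ne_zero (NeZero.ne Lc)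
  have hL1 : (1 : ℝ) < Lc := by exact_mod_cast (lt_of_lt_of_le (by norm_num) hLc : 1 < Lc)
  obtain ⟨cL, δL, hδL, hL⟩ := hL
  obtain ⟨CtL, δt, hδt, hLt⟩ := hLt
  obtain ⟨c₀L, δ0, hc₀L, hδ0, hL0r⟩ := hL0
  obtain ⟨C01, δ01, hδ01, h01⟩ := exists_locStencil_member_zero_one (d := 3) tabs hLc1 ((cE * (Lc : ℝ) ^ (2 * (3 + 1))) ^ 1) cΛ
  -- the constants
  set A : ℝ := (Lc : ℝ) ^ (3 + 1) with hA
  set Y : ℝ := A * (max cL 0 + max CtL 0 + c₀L) + max C01 0 with hY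
  have hA0 : 0 ≤ A := by positivity
  have hY0 : 0 ≤ Y := by positivity
  have hθ0 : 0 ≤ (Lc : ℝ)⁻¹ := by positivity
  have hθ1 : (Lc : ℝ)⁻¹ < 1 := inv_lt_one_of_one_lt₀ hL1
  have hkey : ∀ m : ℕ, (Lc : ℝ) * Y * ((Lc : ℝ)⁻¹) ^ (m + 1) = Y * ((Lc : ℝ)⁻¹) ^ m := by
    intro m
    rw [pow_succ]
    field_simp
  refine ⟨(Lc : ℝ) * Y, (Lc : ℝ)⁻¹, min (min δL δt) (min δ0 δ01), by positivity, hθ0, hθ1,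
    lt_min (lt_min hδL hδt) (lt_min hδ0 hδ01), fun k i hik => ?_⟩
  obtain ⟨n, rfl⟩ := Nat.exists_eq_add_of_lt hik
  cases i with
  | zero =>
    cases n with
    | zero =>
      -- the member (0, 1)
      rw [show 0 + 0 + 1 = 1 by rfl, show 1 - 0 = 1 by rfl]
      refine locStencil_mono' h01 ?_ ((min_le_right _ _).trans (min_le_right _ _))
      rw [show (1 : ℕ) = 0 + 1 by rfl, hkey 0, pow_zero, mul_one]
      exact (le_max_left _ _).trans (le_add_of_nonneg_left (by positivity))
    | succ n =>
      -- birth 0, read n + 2: road S3-L0 at the root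
      rw [show 0 + (n + 1) + 1 = n + 1 + 1 by omega, show n + 1 + 1 - 0 = n + 1 + 1 by omega]
      refine locStencil_mono' (locStencil_lineage_zero_of_row tabs hHff hH hcE cΛ n (hL0r rr hrr n)) ?_ ((min_le_right _ _).trans (min_le_left _ _))
      rw [hkey (n + 1), ← mul_assoc]
      refine mul_le_mul_of_nonneg_right ?_ (pow_nonneg hθ0 _)
      have hb : c₀L ≤ max cL 0 + max CtL 0 + c₀L := by linarith [le_max_right cL 0, le_max_right CtL 0]
      calc A * c₀L ≤ A * (max cL 0 + max CtL 0 + c₀L) := mul_le_mul_of_nonneg_left hb hA0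
        _ ≤ Y := le_add_of_nonneg_right (le_max_right _ _)
  | succ j =>
    cases n with
    | zero =>
      -- birth j + 1, read j + 2: road S3-Lt at the root
      rw [show j + 1 + 0 + 1 = j + 1 + 1 by omega, show j + 1 + 1 - (j + 1) = 1 by omega]
      refine locStencil_mono' (locStencil_lineage_top_of_row tabs hHff hH hcE cΛ j (hLt rr hrr j)) ?_ ((min_le_left _ _).trans (min_le_right _ _))
      rw [show (1 : ℕ) = 0 + 1 by rfl, hkey 0, pow_zero, mul_one]
      have hb : CtL ≤ max cL 0 + max CtL 0 + c₀L := by linarith [le_max_left CtL 0, le_max_right cL 0, hc₀L]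
      calc A * CtL ≤ A * (max cL 0 + max CtL 0 + c₀L) := mul_le_mul_of_nonneg_left hb hA0
        _ ≤ Y := le_add_of_nonneg_right (le_max_right _ _)
    | succ n =>
      -- birth j + 1, read j + n + 3: road S3-L at the root, (n′, m) = (j + n + 1, j)
      rw [show j + 1 + (n + 1) + 1 = j + (n + 1) + 1 + 1 by omega, show j + (n + 1) + 1 + 1 - (j + 1) = n + 1 + 1 by omega]
      refine locStencil_mono' (locStencil_lineage_succ_of_row tabs hHff hH hcE cΛ j (n + 1) (hL rr hrr (j + (n + 1)) j (by omega))) ?_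
        ((min_le_left _ _).trans (min_le_left _ _))
      rw [Nat.add_sub_cancel_left, hkey (n + 1), ← mul_assoc]
      refine mul_le_mul_of_nonneg_right ?_ (pow_nonneg hθ0 _)
      have hb : cL ≤ max cL 0 + max CtL 0 + c₀L := by linarith [le_max_left cL 0, le_max_right CtL 0, hc₀L]
      calc A * cL ≤ A * (max cL 0 + max CtL 0 + c₀L) := mul_le_mul_of_nonneg_left hb hA0
        _ ≤ Y := le_add_of_nonneg_right (le_max_right _ _)


/-! ## §4 The ENDs: the three SYM rows plugged in -/

/-- NOT IN PRINT; OUR BOOKKEEPING ([folklore] assembly; UNCONDITIONAL; the (III′) twin of the OWNER's `BornLambdaRowHolds.exists_hUg_three`).  **THE UNDRESSED Λ-LINEAGE LETTER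
`hUg` OF THE `d = 3` COMB-CHART FAMILY AT THE SYM TABLE HOLDS** at the pin `cE = Lc^4`, every `Lc ≥ 2`, every `cΛ`, every box root `rr` with `tabs.H = symHessFFAt (toSite rr) Lc`:
per lineage `i < k` the weighted undressed member is a local stencil family with constant `C·θ^{k−i}` at one rate (`exists_hUg_of_symRows` with M.69 ∕ M.72 ∕ M.74 BY NAME)
— the letter `hUg` of M.60 `CombBornLambdaSocket.exists_hBLam_of_geometric_three`, VERBATIM. -/
theorem exists_hUg_three (hLc : 2 ≤ Lc) {rr : Fin (3 + 1) → ℕ} (hrr : rr ∈ box (3 + 1) Lc) (hH : tabs.H = symHessFFAt (toSite rr) Lc)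
    {cE : ℝ} (hcE : cE = (Lc : ℝ) ^ (3 + 1)) (cΛ : ℝ) :
    ∃ C θ δ : ℝ, 0 ≤ C ∧ 0 ≤ θ ∧ θ < 1 ∧ 0 < δ ∧ ∀ k i : ℕ, i < k →
      LocStencil (fun κ' u' => (cE * (Lc : ℝ) ^ (2 * (3 + 1))) ^ (k - i) •
        push₃ (respStep (d := 3) (Lc ^ i) (Lc ^ k)) (respStep (d := 3) (Lc ^ i) (Lc ^ k)) (respStep (d := 3) (Lc ^ i) (Lc ^ k))
          (unitS (sfStep Lc i) (smStep 3 Lc i) (combFreshAt tabs 0 cΛ i)) κ' u') (C * θ ^ (k - i)) δ :=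
  exists_hUg_of_symRows tabs hHff hLc hrr hH hcE cΛ (rowL_three_at cΛ) (rowLamTop_at (le_trans (by norm_num) hLc) cΛ)
    (rowL0_holds_at (le_trans (by norm_num) hLc) cΛ)

/-- NOT IN PRINT; OUR BOOKKEEPING ([folklore] assembly; UNCONDITIONAL).  **THE SUMMED LETTER `hU` OF M.60 `exists_hBLam_of_letters_three` HOLDS** at the sym table
(`exists_hUg_three` + M.60 `exists_hU_of_geometric`). -/
theorem exists_hU_three (hLc : 2 ≤ Lc) {rr : Fin (3 + 1) → ℕ} (hrr : rr ∈ box (3 + 1) Lc) (hH : tabs.H = symHessFFAt (toSite rr) Lc)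
    {cE : ℝ} (hcE : cE = (Lc : ℝ) ^ (3 + 1)) (cΛ : ℝ) :
    ∃ C δ : ℝ, 0 < δ ∧ ∀ k : ℕ,
      LocStencil (∑ i ∈ Finset.range k, fun κ' u' => (cE * (Lc : ℝ) ^ (2 * (3 + 1))) ^ (k - i) •
        push₃ (respStep (d := 3) (Lc ^ i) (Lc ^ k)) (respStep (d := 3) (Lc ^ i) (Lc ^ k)) (respStep (d := 3) (Lc ^ i) (Lc ^ k))
          (unitS (sfStep Lc i) (smStep 3 Lc i) (combFreshAt tabs 0 cΛ i)) κ' u') C δ :=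
  exists_hU_of_geometric tabs cE cΛ (exists_hUg_three tabs hHff hLc hrr hH hcE cΛ)

/-- NOT IN PRINT; OUR PROOF ATTEMPT — CONDITIONAL ON ONE LETTER ([folklore] assembly; the (III′) twin of `BornLambdaRowHolds.exists_hBLam_three_of_contact`).  **THE (III′) Λ-BORN
ROW `hL` OF M.57 FROM THE CONTACT LETTER `hCg` ALONE** at the sym table: the per-lineage geometric contact letter for the conjugated chains
`T″_i = legChain (fun j ↦ legComp ψ♭ (respStepBmSeq ρ_c Lc j)) i (k−1−i)` ⇒ `∃ C δ, 0 < δ ∧ ∀ k, LocStencil (unitS_k (combBornOf Lc tabs cE 0 cΛ k)) C δ` (the undressed row and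
the source letter are discharged).  NOT the born row `hB` (the V half is separate), NOT hS0-comb, NEVER «G-an2-4 closed». -/
theorem exists_hBLam_three_of_contact (hLc : 2 ≤ Lc) {rr : Fin (3 + 1) → ℕ} (hrr : rr ∈ box (3 + 1) Lc) (hH : tabs.H = symHessFFAt (toSite rr) Lc)
    {cE : ℝ} (hcE : cE = (Lc : ℝ) ^ (3 + 1)) (cΛ : ℝ)
    (hCg : ∃ C θ δ : ℝ, 0 ≤ C ∧ 0 ≤ θ ∧ θ < 1 ∧ 0 < δ ∧ ∀ k i : ℕ, i < k →
      LocStencil (fun κ' u' => (cE * (Lc : ℝ) ^ (2 * (3 + 1))) ^ (k - i) •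
        (push₃
            (legChain (fun j => legComp (fun α x κ u => psiKS (ctrOff (3 + 1) Lc) Lc u x (Sum.inl κ) (Sum.inl α)) (respStepBmSeq (d := 3) (ctr (3 + 1) Lc) Lc j)) i (k - 1 - i))
            (legChain (fun j => legComp (fun α x κ u => psiKS (ctrOff (3 + 1) Lc) Lc u x (Sum.inl κ) (Sum.inl α)) (respStepBmSeq (d := 3) (ctr (3 + 1) Lc) Lc j)) i (k - 1 - i))
            (legChain (fun j => legComp (fun α x κ u => psiKS (ctrOff (3 + 1) Lc) Lc u x (Sum.inl κ) (Sum.inl α)) (respStepBmSeq (d := 3) (ctr (3 + 1) Lc) Lc j)) i (k - 1 - i))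
            (unitS (sfStep Lc i) (smStep 3 Lc i) (combFreshAt tabs 0 cΛ i)) κ' u'
          - push₃ (respStep (d := 3) (Lc ^ i) (Lc ^ k)) (respStep (d := 3) (Lc ^ i) (Lc ^ k)) (respStep (d := 3) (Lc ^ i) (Lc ^ k))
            (unitS (sfStep Lc i) (smStep 3 Lc i) (combFreshAt tabs 0 cΛ i)) κ' u')) (C * θ ^ (k - i)) δ) :
    ∃ C δ : ℝ, 0 < δ ∧ ∀ k : ℕ, LocStencil (unitS (sfStep Lc k) (smStep 3 Lc k) (combBornOf Lc tabs cE 0 cΛ k)) C δ :=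
  exists_hBLam_of_geometric_three tabs hHff cE cΛ (exists_hUg_three tabs hHff hLc hrr hH hcE cΛ) hCg

end Socket

end Summit.QuantumFields.BalabanUV.Beta.GAN24.CombBornLambdaUndressedRow

end
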